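/-
Origin: expansion seat `planner-pub-hodgecm-pv02-g7-0`, handover ONE: `import Pv02g7.WeilThetaModelLinear` -> `import HodgeCM.Automorphic.WeilThetaModelLinear`; other import HodgeCM.PerL34.ArchAWeilGenuineWitness (r28) unchanged ; after row 1 of this kit (WeilThetaModelLinear) and after ArchAWeilGenuineWitness (RUN 28); HOLD iff row 1 is held (`HOME/pub-hodgecm-pv02-g7/lean/Pv02g7/ArchAWeilLinear.lean`, md5 5fb8f5b4, 236 lines);
landed by the gen-8 packager in gate run 29 as `HodgeCM/PerL34/ArchAWeilLinear.lean` (import ^import Pv02g7\.WeilThetaModelLinear[ \t]*$→import HodgeCM.Automorphic.WeilThetaModelLinear ×1).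
-/
/-
Origin: HOME/pub-hodgecm-pv02-g7/lean/Pv02g7/ArchAWeilLinear.lean — session planner-pub-hodgecm-pv02-g7-0
(unit pub-hodgecm-pv02-g7, DAG-NODE PROVER #02 gen 7; lineage pv02).
Intended final place (packager's call): `HodgeCM/PerL34/ArchAWeilLinear.lean`.
NEW ADDITIVE LEAF.  WIP import ↦ landed name: `Pv02g7.WeilThetaModelLinear` ↦ `HodgeCM.Automorphic.WeilThetaModelLinear`
(this seat's #1; lands AFTER it); the other import is the TREE module `HodgeCM.PerL34.ArchAWeilGenuineWitness` (pv02-g6, r28).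
KIND: KERNEL — nothing cited, nothing posited; no statement of PerL / QW8 / the 2001 programme is a hypothesis.
-/
import Summits.HodgeConjecture.HodgeCM.PerL34.ArchAWeilGenuineWitness
import Summits.HodgeConjecture.HodgeCM.Automorphic.WeilThetaModelLinear_2

/-!
# Linear Weil theta models are stable under pull-back and under passing to `K`-finite vectors;
# the genuine-torus N27 witness is a linear Weil theta model

For a LINEAR Weil theta model `M` (`WeilThetaModel.LinearStr`, this seat's `WeilThetaModelLinear`):

* §1 the kernel-side `𝒮` of pv02's `ArchAWeil` (`kerSpan M = span {θ_Φ}`) IS the image of the linear map `Φ ↦ θ_Φ`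
  (`kerSpan_eq_range`: every element of the theta space is a single kernel `θ_Φ` — PerL v5 ll. 265–268 read
  literally), and the `U(W_{i,b})`-orbit spans are subadditive: `orbitSpan (Φ + Ψ) ≤ orbitSpan Φ ⊔ orbitSpan Ψ`,
  `orbitSpan (a • Φ) ≤ orbitSpan Φ`, `orbitSpan 0 = ⊥`;
* §2 hence pv02-g6's `K`-FINITE VECTORS `finiteSK` form a `ℂ`-SUBMODULE of `S(X_A)` (`finiteSKsub`), and the
  `K`-finite sub-model `M.kFinite ι` is again LINEAR (instance), with `kFiniteIncl` linear (`kFiniteInclₗ`);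
* §3 pv02-g6's pull-back `M.comapRight f hf hΓ` is LINEAR (instance: same `W`, same `𝒮^κ`);
* §4 so the CONSTRUCTED genuine-torus model `ArchAWeil.genuineSchrodingerModel E Λ m Γ hΓ L χ` of pv02-g6 (on which
  N27 = PerL Lemma 4.1(a) holds with no hypothesis, `exists_genuine_model_N27`) is a linear Weil theta model, and so
  is each of its `K`-finite sub-models: the class `LinearStr` is inhabited by the N27 witness of record.
-/

set_option autoImplicit false

noncomputable section

namespace HodgeCM

/-! ## 1. Kernel spans under linearity -/

namespace PerL34
namespace ArchAWeil

variable {GU : Type} [Group GU] [TopologicalSpace GU] [IsTopologicalGroup GU] {ΓU : Subgroup GU}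
variable {G : Type} [CommGroup G] [TopologicalSpace G] [IsTopologicalGroup G] {Γ : Subgroup G}
variable (M : WeilThetaModel GU ΓU G Γ) [M.LinearStr] {RealPl : Type} (ι : RealPl → (Circle →* G))

/-- **Under linearity the kernel-side `𝒮` is the image of `Φ ↦ θ_Φ`**: `span {θ_Φ : Φ ∈ 𝒮^κ} = range θₗ`. -/
theorem kerSpan_eq_range : kerSpan M = LinearMap.range M.θₗ := by
  refine le_antisymm (Submodule.span_le.mpr ?_) ?_
  · rintro _ ⟨Φ, rfl⟩
    exact ⟨Φ, rfl⟩
  · rintro _ ⟨Φ, rfl⟩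
    exact θ_mem_kerSpan M Φ

/-- Every element of the theta space is a single theta kernel. -/
theorem mem_kerSpan_iff (F : C((GU ⧸ ΓU) × (G ⧸ Γ), ℂ)) : F ∈ kerSpan M ↔ ∃ Φ : M.SK, M.θ Φ = F := by
  rw [kerSpan_eq_range, LinearMap.mem_range]
  rfl

/-- The orbit span of a sum lies in the sup of the orbit spans. -/
theorem orbitSpan_add_le (b : RealPl) (Φ Ψ : M.SK) :
    orbitSpan M ι b (Φ + Ψ) ≤ orbitSpan M ι b Φ ⊔ orbitSpan M ι b Ψ := by
  refine Submodule.span_le.mpr ?_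
  rintro _ ⟨u, rfl⟩
  simp only [WeilThetaModel.omg_add, WeilThetaModel.θ_add, SetLike.mem_coe]
  exact Submodule.add_mem_sup (θ_omg_mem_orbitSpan M ι b Φ u) (θ_omg_mem_orbitSpan M ι b Ψ u)

/-- The orbit span of a scalar multiple lies in the orbit span. -/
theorem orbitSpan_smul_le (b : RealPl) (a : ℂ) (Φ : M.SK) :
    orbitSpan M ι b (a • Φ) ≤ orbitSpan M ι b Φ := by
  refine Submodule.span_le.mpr ?_
  rintro _ ⟨u, rfl⟩
  simp only [WeilThetaModel.omg_smul, WeilThetaModel.θ_smul, SetLike.mem_coe]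
  exact Submodule.smul_mem _ a (θ_omg_mem_orbitSpan M ι b Φ u)

/-- (Ported verbatim from the HodgeCMPerL package; no docstring in the source.) -/
@[simp] theorem orbitSpan_zero (b : RealPl) : orbitSpan M ι b (0 : M.SK) = ⊥ := by
  rw [eq_bot_iff]
  refine Submodule.span_le.mpr ?_
  rintro _ ⟨u, rfl⟩
  simp only [WeilThetaModel.omg_zero, WeilThetaModel.θ_zero, SetLike.mem_coe]
  exact Submodule.zero_mem _

/-- The orbit span lies in the image of `θₗ`. -/
theorem orbitSpan_le_range (b : RealPl) (Φ : M.SK) : orbitSpan M ι b Φ ≤ LinearMap.range M.θₗ :=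
  (orbitSpan_le_kerSpan M ι b Φ).trans (kerSpan_eq_range M).le

end ArchAWeil
end PerL34

/-! ## 2. The `K`-finite vectors form a submodule; `M.kFinite ι` is linear -/

namespace WeilThetaModel

open PerL34 PerL34.ArchAWeil

section KFinite

variable {GU : Type} [Group GU] [TopologicalSpace GU] [IsTopologicalGroup GU] {ΓU : Subgroup GU}
variable {G : Type} [CommGroup G] [TopologicalSpace G] [IsTopologicalGroup G] {Γ : Subgroup G}
variable (M : WeilThetaModel GU ΓU G Γ) [M.LinearStr] {RealPl : Type} (ι : RealPl → (Circle →* G))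

/-- (Ported verbatim from the HodgeCMPerL package; no docstring in the source.) -/
theorem zero_mem_finiteSK : (0 : M.W.SX) ∈ M.finiteSK ι :=
  M.mem_finiteSK ι LinearStr.zero_mem fun b => by
    rw [show (⟨0, LinearStr.zero_mem⟩ : M.SK) = 0 from rfl, orbitSpan_zero]
    infer_instance

/-- (Ported verbatim from the HodgeCMPerL package; no docstring in the source.) -/
theorem add_mem_finiteSK {Φ Ψ : M.W.SX} (hΦ : Φ ∈ M.finiteSK ι) (hΨ : Ψ ∈ M.finiteSK ι) :
    Φ + Ψ ∈ M.finiteSK ι := by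
  have hΦ' := (M.mem_finiteSK_iff ι ⟨Φ, hΦ.1⟩).mp hΦ
  have hΨ' := (M.mem_finiteSK_iff ι ⟨Ψ, hΨ.1⟩).mp hΨ
  refine M.mem_finiteSK ι (LinearStr.add_mem hΦ.1 hΨ.1) fun b => ?_
  haveI := hΦ' b
  haveI := hΨ' b
  have hle : orbitSpan M ι b (⟨Φ, hΦ.1⟩ + ⟨Ψ, hΨ.1⟩) ≤ orbitSpan M ι b ⟨Φ, hΦ.1⟩ ⊔ orbitSpan M ι b ⟨Ψ, hΨ.1⟩ :=
    orbitSpan_add_le M ι b _ _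
  exact Submodule.finiteDimensional_of_le hle

/-- (Ported verbatim from the HodgeCMPerL package; no docstring in the source.) -/
theorem smul_mem_finiteSK (a : ℂ) {Φ : M.W.SX} (hΦ : Φ ∈ M.finiteSK ι) : a • Φ ∈ M.finiteSK ι := by
  have hΦ' := (M.mem_finiteSK_iff ι ⟨Φ, hΦ.1⟩).mp hΦ
  refine M.mem_finiteSK ι (LinearStr.smul_mem a hΦ.1) fun b => ?_
  haveI := hΦ' b
  have hle : orbitSpan M ι b (a • ⟨Φ, hΦ.1⟩) ≤ orbitSpan M ι b ⟨Φ, hΦ.1⟩ := orbitSpan_smul_le M ι b a _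
  exact Submodule.finiteDimensional_of_le hle

/-- **The `K`-finite vectors of a linear Weil theta model form a `ℂ`-submodule of `S(X_A)`** (contained in `𝒮^κ`). -/
def finiteSKsub : Submodule ℂ M.W.SX where
  carrier := M.finiteSK ι
  zero_mem' := M.zero_mem_finiteSK ι
  add_mem' := M.add_mem_finiteSK ι
  smul_mem' := M.smul_mem_finiteSK ι

/-- (Ported verbatim from the HodgeCMPerL package; no docstring in the source.) -/
@[simp] theorem mem_finiteSKsub (Φ : M.W.SX) : Φ ∈ M.finiteSKsub ι ↔ Φ ∈ M.finiteSK ι := Iff.rfl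

/-- (Ported verbatim from the HodgeCMPerL package; no docstring in the source.) -/
theorem finiteSKsub_le : M.finiteSKsub ι ≤ M.SKsub := fun _ h => h.1

/-- **The `K`-finite sub-model of a linear Weil theta model is linear** (same `S(X_A)`, `act`, `Θ`; `𝒮^κ_fin` a
submodule by §1). -/
instance LinearStr.kFinite : (M.kFinite ι).LinearStr where
  instACG := inferInstanceAs (AddCommGroup M.W.SX)
  instMod := inferInstanceAs (Module ℂ M.W.SX)
  act_add := LinearStr.act_add (M := M)
  act_smul := LinearStr.act_smul (M := M)
  theta_add := LinearStr.theta_add (M := M)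
  theta_smul := LinearStr.theta_smul (M := M)
  zero_mem := M.zero_mem_finiteSK ι
  add_mem := fun hΦ hΨ => M.add_mem_finiteSK ι hΦ hΨ
  smul_mem := fun a _ hΦ => M.smul_mem_finiteSK ι a hΦ

/-- (Ported verbatim from the HodgeCMPerL package; no docstring in the source.) -/
theorem kFiniteIncl_add (Φ Ψ : (M.kFinite ι).SK) :
    M.kFiniteIncl ι (Φ + Ψ) = M.kFiniteIncl ι Φ + M.kFiniteIncl ι Ψ := rfl

/-- (Ported verbatim from the HodgeCMPerL package; no docstring in the source.) -/
theorem kFiniteIncl_smul (a : ℂ) (Φ : (M.kFinite ι).SK) :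
    M.kFiniteIncl ι (a • Φ) = a • M.kFiniteIncl ι Φ := rfl

/-- The inclusion `𝒮^κ_fin ⊆ 𝒮^κ` as a `ℂ`-linear map (injective, `ω`- and `θ`-compatible by pv02-g6's
`kFiniteIncl_omg / θ_kFinite`). -/
def kFiniteInclₗ : (M.kFinite ι).SK →ₗ[ℂ] M.SK where
  toFun := M.kFiniteIncl ι
  map_add' := M.kFiniteIncl_add ι
  map_smul' := M.kFiniteIncl_smul ι

/-- (Ported verbatim from the HodgeCMPerL package; no docstring in the source.) -/
@[simp] theorem kFiniteInclₗ_apply (Φ : (M.kFinite ι).SK) : M.kFiniteInclₗ ι Φ = M.kFiniteIncl ι Φ := rfl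

/-- (Ported verbatim from the HodgeCMPerL package; no docstring in the source.) -/
theorem kFiniteInclₗ_injective : Function.Injective (M.kFiniteInclₗ ι) := M.kFiniteIncl_injective ι

/-- `θₗ` of the sub-model factors through `θₗ` of `M`. -/
theorem θₗ_kFinite : (M.kFinite ι).θₗ = M.θₗ.comp (M.kFiniteInclₗ ι) := rfl

/-- `ωₗ(h)` of the sub-model is the restriction of `ωₗ(h)`. -/
theorem kFiniteInclₗ_comp_omgₗ (h : G) :
    (M.kFiniteInclₗ ι).comp ((M.kFinite ι).omgₗ h) = (M.omgₗ h).comp (M.kFiniteInclₗ ι) := rfl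

end KFinite

/-! ## 3. Pull-backs of linear models are linear -/

section ComapRight

variable {GU : Type} [Group GU] [TopologicalSpace GU] {ΓU : Subgroup GU}
variable {G : Type} [Group G] [TopologicalSpace G] {Γ : Subgroup G}
variable {G' : Type} [Group G'] [TopologicalSpace G'] {Γ' : Subgroup G'}
variable (M : WeilThetaModel GU ΓU G' Γ') [M.LinearStr] (f : G →* G') (hf : Continuous f) (hΓ : ∀ γ ∈ Γ, f γ ∈ Γ')

/-- **The pull-back of a linear Weil theta model along the second group is linear** (same `W`, same `𝒮^κ`). -/
instance LinearStr.comapRight : (M.comapRight f hf hΓ).LinearStr where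
  instACG := inferInstanceAs (AddCommGroup M.W.SX)
  instMod := inferInstanceAs (Module ℂ M.W.SX)
  act_add := LinearStr.act_add (M := M)
  act_smul := LinearStr.act_smul (M := M)
  theta_add := LinearStr.theta_add (M := M)
  theta_smul := LinearStr.theta_smul (M := M)
  zero_mem := LinearStr.zero_mem (M := M)
  add_mem := LinearStr.add_mem (M := M)
  smul_mem := fun a _ h => LinearStr.smul_mem (M := M) a h

/-- The linear structure of `𝒮^κ` is unchanged by the pull-back (`rfl` on carriers). -/
theorem coe_add_comapRight (Φ Ψ : (M.comapRight f hf hΓ).SK) : (Φ + Ψ).1 = Φ.1 + Ψ.1 := rfl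

end ComapRight

end WeilThetaModel

/-! ## 4. The genuine-torus N27 witness is a linear Weil theta model -/

namespace PerL34
namespace ArchAWeil

open NumberField NumberField.SeesawTorus

variable (E : Type) [NormedAddCommGroup E] [NormedSpace ℝ E] [FiniteDimensional ℝ E]
  (Λ : Submodule ℤ E) [DiscreteTopology Λ] (m : ℤ) (Γ : Subgroup Circle) (hΓ : ∀ u ∈ Γ, u ^ m = 1)
variable (L : Type) [Field L] [NumberField L]
variable (χ : PontryaginDual (relNormOneIdeles (maximalRealSubfield L) L ⧸ relNormOneRat (maximalRealSubfield L) L))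

/-- **pv02-g6's genuine-torus model `genuineSchrodingerModel` is LINEAR** (pull-back of pv14-g4's linear
Schrödinger–lattice model). -/
instance linearStr_genuineSchrodingerModel : (genuineSchrodingerModel E Λ m Γ hΓ L χ).LinearStr :=
  inferInstanceAs (((SchwartzWeil.schrodingerModel E Λ m Γ hΓ).comapRight (charIdeles L χ)
    (continuous_charIdeles L χ) (charIdeles_mem_of_mem_rat L χ Γ)).LinearStr)

/-- … and so is each of its `K`-finite sub-models (§2). -/
example [IsCMField L] :
    ((genuineSchrodingerModel E Λ m Γ hΓ L χ).kFinite (realPlaceCircle L)).LinearStr :=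
  inferInstance

/-- On the genuine model `Φ ↦ θ_Φ` is a `ℂ`-linear map out of ALL of `𝓢(E, ℂ)` (`SK = univ`):
`θ_{Φ+Ψ} = θ_Φ + θ_Ψ` for the genuine-torus kernels. -/
theorem θ_genuineSchrodinger_add (Φ Ψ : (genuineSchrodingerModel E Λ m Γ hΓ L χ).SK) :
    (genuineSchrodingerModel E Λ m Γ hΓ L χ).θ (Φ + Ψ) =
      (genuineSchrodingerModel E Λ m Γ hΓ L χ).θ Φ + (genuineSchrodingerModel E Λ m Γ hΓ L χ).θ Ψ :=
  (genuineSchrodingerModel E Λ m Γ hΓ L χ).θ_add Φ Ψ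

end ArchAWeil
end PerL34

end HodgeCM

end
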